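import Literature.NumberTheory.LFunctions.XiHigherDerivativesCriticalZeros
import Mathlib.Analysis.Complex.JensenFormula
import HarnessLib

/-!
# A positive proportion of the zeros of every `ξ^{(m)}` lies on the critical line: `κ′_m > 0` for all `m`

RH-FREE (every statement below is an unconditional theorem of this tree; nothing here bears on the truth
of RH). Topic `Literature/NumberTheory/LFunctions`; PROOF LAYER for `xiDerivCriticalLineProportion m` of
`XiDerivativeZeros.lean` (J. B. Conrey, *Zeros of derivatives of Riemann's ξ-function on the critical
line*, J. Number Theory **16** (1983) 49–74, key `Conrey1983`).

Conrey's Theorem (p. 49–50) with his Lemma 2 gives, for every `m ≥ 1`, an explicit positive lower bound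
for the proportion `κ′_m` of zeros of `ξ^{(m)}` on the critical line (`κ′₁ ≥ 0.8137`, `κ′₂ ≥ 0.9584`, …,
`κ′_m = 1 + O(m⁻²)`; Levinson's method). Those bounds are NOT proved here. This file proves the
QUALITATIVE SHADOW **`0 < κ′_m` for every `m`** (`xiDerivCriticalLineProportion_pos`), unconditionally,
from two kernel theorems of the tree:

* the lower bound `N^{(m)}₀(T) ≥ (2/3 − ε)(T/2π) log T` for all large `T`
  (`eventually_two_thirds_mul_main_le_xiDerivCriticalZeroCount_higher`, `XiHigherDerivativesCriticalZeros.lean`: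
  `m`-fold Rolle from the simple critical zeros of `ζ`, [AF26] Theorem A (i));
* the crude upper bound **`N^{(m)}(T) ≤ K_m · T log T`** for all large `T`
  (`exists_xiDerivZeroCount_le_mul_log`), by Jensen's inequality (Mathlib's `AnalyticOnNhd.sum_divisor_le`)
  for `ξ^{(m)}` on the disc `|s − 5/2| ≤ T + 3` (which contains the box `0 < Re s < 1`, `0 < Im s ≤ T`;
  `ξ^{(m)}(5/2) ≠ 0` by Conrey's Lemma 2), with the order-one growth
  `‖ξ^{(m)}(s)‖ ≤ C e^{A(‖s‖+m) log(1+‖s‖+m)}` (`XiDerivJensenCount.norm_iteratedDeriv_riemannXi_le`,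
  Cauchy's estimate iterated from Titchmarsh's Thm. 2.12, tree `riemannXi_order_le_one_holds`). Conrey's
  Lemma 2 gives the true order `N^{(m)}(T) ~ (T/2π) log T`; the tree has it for `m = 1` only
  (`XiDerivativeZeroCountingFunction.lean`), which is why the constant here is poor but the statement holds
  for every `m`.

AI-produced formalisation (literature-prover-rh-lit-frontier-1-g12-0, 2026-08-27); AI review is weaker
than expert review. No endorsement of any preprint is implied.

## References

* J. B. Conrey, J. Number Theory 16 (1983) 49–74: Theorem and Corollary (pp. 49–50), Lemma 2 (p. 52).
* E. C. Titchmarsh, *The Theory of the Riemann Zeta-Function*, 2nd ed., Thm. 2.12, §9.4 (Jensen).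
-/

noncomputable section

open Complex Filter Set Topology Metric MeromorphicOn

namespace Literature.NumberTheory.LFunctions

open Literature.Analysis.Complex XiDerivCritical

namespace XiDerivJensenCount

/-- **Order-one growth of all derivatives of `ξ`**: there are `A, C ≥ 0`, `C ≥ 1`, with
`‖ξ^{(m)}(s)‖ ≤ C exp(A (‖s‖ + m) log(1 + ‖s‖ + m))` for every `m` and `s` (Titchmarsh Thm. 2.12 for
`m = 0`; Cauchy's estimate on circles of radius `1`, `m` times). [cite: Titchmarsh1986, Thm. 2.12 eq. (2.12.3)] -/
theorem norm_iteratedDeriv_riemannXi_le :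
    ∃ A C : ℝ, 0 ≤ A ∧ 1 ≤ C ∧ ∀ (m : ℕ) (s : ℂ),
      ‖iteratedDeriv m riemannXi s‖ ≤
        C * Real.exp (A * (‖s‖ + m) * Real.log (1 + ‖s‖ + m)) := by
  obtain ⟨A₀, C₀, h⟩ := riemannXi_order_le_one_holds
  refine ⟨|A₀|, max C₀ 1, abs_nonneg _, le_max_right _ _, fun m ↦ ?_⟩
  induction m with
  | zero =>
    intro s
    have hlog : 0 ≤ Real.log (1 + ‖s‖) := Real.log_nonneg (by linarith [norm_nonneg s])
    have hC : 0 ≤ max C₀ 1 := le_trans zero_le_one (le_max_right _ _)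
    have hexp : A₀ * ‖s‖ * Real.log (1 + ‖s‖) ≤
        |A₀| * (‖s‖ + ((0 : ℕ) : ℝ)) * Real.log (1 + ‖s‖ + ((0 : ℕ) : ℝ)) := by
      rw [Nat.cast_zero, add_zero, add_zero, mul_assoc, mul_assoc]
      exact mul_le_mul_of_nonneg_right (le_abs_self A₀) (mul_nonneg (norm_nonneg _) hlog)
    calc ‖iteratedDeriv 0 riemannXi s‖ = ‖riemannXi s‖ := by rw [iteratedDeriv_zero]
      _ ≤ C₀ * Real.exp (A₀ * ‖s‖ * Real.log (1 + ‖s‖)) := h s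
      _ ≤ max C₀ 1 * Real.exp (A₀ * ‖s‖ * Real.log (1 + ‖s‖)) :=
          mul_le_mul_of_nonneg_right (le_max_left _ _) (Real.exp_pos _).le
      _ ≤ max C₀ 1 * Real.exp (|A₀| * (‖s‖ + ((0 : ℕ) : ℝ)) * Real.log (1 + ‖s‖ + ((0 : ℕ) : ℝ))) :=
          mul_le_mul_of_nonneg_left (Real.exp_le_exp.2 hexp) hC
  | succ m ih =>
    intro s
    have hC : 0 ≤ max C₀ 1 := le_trans zero_le_one (le_max_right _ _)
    set B : ℝ := max C₀ 1 *
      Real.exp (|A₀| * (‖s‖ + ((m + 1 : ℕ) : ℝ)) * Real.log (1 + ‖s‖ + ((m + 1 : ℕ) : ℝ))) with hB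
    have hsphere : ∀ w ∈ sphere s 1, ‖iteratedDeriv m riemannXi w‖ ≤ B := by
      intro w hw
      have hw1 : ‖w‖ ≤ ‖s‖ + 1 := by
        have : ‖w - s‖ = 1 := by rwa [mem_sphere_iff_norm] at hw
        calc ‖w‖ = ‖(w - s) + s‖ := by ring_nf
          _ ≤ ‖w - s‖ + ‖s‖ := norm_add_le _ _
          _ = ‖s‖ + 1 := by rw [this]; ring
      refine (ih w).trans ?_
      rw [hB]
      refine mul_le_mul_of_nonneg_left (Real.exp_le_exp.2 ?_) hC
      have h1 : ‖w‖ + (m : ℝ) ≤ ‖s‖ + ((m + 1 : ℕ) : ℝ) := by push_cast; linarith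
      have h2 : Real.log (1 + ‖w‖ + (m : ℝ)) ≤ Real.log (1 + ‖s‖ + ((m + 1 : ℕ) : ℝ)) :=
        Real.log_le_log (by positivity) (by push_cast; linarith)
      have h3 : 0 ≤ Real.log (1 + ‖w‖ + (m : ℝ)) := Real.log_nonneg (by linarith [norm_nonneg w])
      have h4 : 0 ≤ |A₀| * (‖s‖ + ((m + 1 : ℕ) : ℝ)) := by positivity
      calc |A₀| * (‖w‖ + m) * Real.log (1 + ‖w‖ + m)
          ≤ |A₀| * (‖s‖ + ((m + 1 : ℕ) : ℝ)) * Real.log (1 + ‖w‖ + m) := by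
            gcongr
        _ ≤ |A₀| * (‖s‖ + ((m + 1 : ℕ) : ℝ)) * Real.log (1 + ‖s‖ + ((m + 1 : ℕ) : ℝ)) :=
            mul_le_mul_of_nonneg_left h2 h4
    have hd : Differentiable ℂ (iteratedDeriv m riemannXi) :=
      differentiable_iteratedDeriv_of_entire differentiable_riemannXi m
    have hcauchy := Complex.norm_deriv_le_of_forall_mem_sphere_norm_le zero_lt_one hd.diffContOnCl
      hsphere
    rw [div_one] at hcauchy
    rw [iteratedDeriv_succ]
    exact hcauchy

/-- **Jensen's inequality for `ξ^{(m)}` on the disc `|s − 5/2| ≤ T + 3`** (which contains every zero of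
`ξ^{(m)}` with `0 < Im s ≤ T`, these having `0 < Re s < 1`): if `‖ξ^{(m)}‖ ≤ M` (`M ≥ 1`) on the circle
`|s − 5/2| = 2(T + 3)`, then `N^{(m)}(T) ≤ log(M/|ξ^{(m)}(5/2)|)/log 2`.
[cite: Titchmarsh1986, §9.4 (Jensen's theorem applied to zero counting)] -/
theorem xiDerivZeroCount_le_jensen (m : ℕ) {T : ℝ} (hT : 0 ≤ T) {M : ℝ} (hM1 : 1 ≤ M)
    (hM : ∀ z ∈ sphere (5 / 2 : ℂ) (2 * (T + 3)), ‖iteratedDeriv m riemannXi z‖ ≤ M) :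
    (xiDerivZeroCount m T : ℝ) ≤
      Real.log (M / ‖iteratedDeriv m riemannXi (5 / 2)‖) / Real.log 2 := by
  classical
  set f : ℂ → ℂ := iteratedDeriv m riemannXi with hf
  set c : ℂ := 5 / 2 with hc
  set r : ℝ := T + 3 with hr
  have hr0 : 0 < r := by rw [hr]; linarith
  have hcre : c.re = 5 / 2 := by rw [hc]; norm_num
  have hcim : c.im = 0 := by rw [hc]; norm_num
  have hfc : f c ≠ 0 := iteratedDeriv_riemannXi_ne_zero_of_one_le_re m (by rw [hcre]; norm_num)
  have han : AnalyticOnNhd ℂ f (closedBall c |2 * r|) := fun z _ ↦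
    analyticOnNhd_iteratedDeriv_riemannXi m z trivial
  have hJ := AnalyticOnNhd.sum_divisor_le (f := f) (c := c) (r := r) (R := 2 * r)
    (by rw [abs_of_pos hr0]; exact hr0)
    (by rw [abs_of_pos hr0, abs_of_pos (by linarith)]; linarith) hM1 han hfc
    (fun z hz ↦ hM z (by rwa [abs_of_pos (by linarith : (0 : ℝ) < 2 * r)] at hz))
  rw [abs_of_pos hr0, show (2 * r / r) = 2 by field_simp] at hJ
  refine le_trans ?_ hJ
  -- compare `N^{(m)}(T)` with the divisor sum on the disc
  set U : Set ℂ := closedBall c r with hU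
  have hanU : AnalyticOnNhd ℂ f U := fun z _ ↦ analyticOnNhd_iteratedDeriv_riemannXi m z trivial
  set D := divisor f U with hD
  have hfin : (Function.support fun u ↦ (D u : ℝ)).Finite := by
    refine (D.finiteSupport (isCompact_closedBall _ _)).subset fun u hu ↦ ?_
    simpa using hu
  have hcast : ((∑ᶠ u, D u : ℤ) : ℝ) = ∑ᶠ u, (D u : ℝ) :=
    map_finsum (Int.castRingHom ℝ) (D.finiteSupport (isCompact_closedBall _ _))
  rw [hcast, finsum_eq_sum_of_support_subset _ (s := hfin.toFinset) (by simp)]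
  have hB := xiDerivZeroBox_finite m T
  unfold xiDerivZeroCount
  rw [finsum_mem_eq_finite_toFinset_sum _ hB]
  push_cast
  -- each zero in the box lies in `U` and carries divisor `=` its (positive) multiplicity
  have hDs : ∀ s ∈ hB.toFinset,
      ((analyticOrderAt f s).toNat : ℝ) = D s ∧ (0 : ℝ) < D s := by
    intro s hs
    rw [Set.Finite.mem_toFinset] at hs
    obtain ⟨hfs, him0, himT⟩ := hs
    obtain ⟨hre0, hre1⟩ := Conrey1983_lemma2_strip m hfs
    have hsU : s ∈ U := by
      rw [hU, mem_closedBall, dist_eq_norm]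
      calc ‖s - c‖ ≤ |(s - c).re| + |(s - c).im| := norm_le_abs_re_add_abs_im _
        _ ≤ 5 / 2 + T := by
            rw [sub_re, sub_im, hcre, hcim, sub_zero]
            have h1 : |s.re - 5 / 2| ≤ 5 / 2 := by rw [abs_le]; constructor <;> linarith
            have h2 : |s.im| ≤ T := by rw [abs_le]; constructor <;> linarith
            linarith
        _ ≤ r := by rw [hr]; linarith
    obtain ⟨n, hn⟩ := ENat.ne_top_iff_exists.mp (XiDerivCritical.analyticOrderAt_ne_top m s)
    have hDn : D s = n := by
      rw [hD, AnalyticOnNhd.divisor_apply hanU hsU, ← hn, ENat.map_coe, WithTop.untop₀_coe]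
    have htoNat : (analyticOrderAt f s).toNat = n := by rw [← hn, ENat.toNat_coe]
    have hn1 : 1 ≤ n := by
      have := XiDerivCritical.one_le_analyticOrderAt_toNat m hfs
      rwa [htoNat] at this
    refine ⟨by rw [htoNat, hDn, Int.cast_natCast], ?_⟩
    rw [hDn, Int.cast_natCast]
    exact Nat.cast_pos.2 (by omega)
  have hsub : hB.toFinset ⊆ hfin.toFinset := by
    intro s hs
    have h := (hDs s hs).2
    rw [Set.Finite.mem_toFinset, Function.mem_support]
    exact h.ne'
  calc ∑ s ∈ hB.toFinset, ((analyticOrderAt f s).toNat : ℝ)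
      = ∑ s ∈ hB.toFinset, (D s : ℝ) := Finset.sum_congr rfl fun s hs ↦ (hDs s hs).1
    _ ≤ ∑ u ∈ hfin.toFinset, (D u : ℝ) :=
        Finset.sum_le_sum_of_subset_of_nonneg hsub fun u _ _ ↦ by
          exact_mod_cast hanU.divisor_nonneg u

end XiDerivJensenCount

open XiDerivJensenCount

/-- **Crude upper bound `N^{(m)}(T) ≤ K · T log T`** for all large `T`, every `m` (Jensen's inequality on
`|s − 5/2| ≤ T + 3` with the order-one growth of `ξ^{(m)}`). Conrey's Lemma 2 gives the true order
`N^{(m)}(T) = (T/2π) log(T/2π) − T/2π + O_m(log T)` (tree: `m = 1` only); this weaker bound is what the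
tree proves for every `m`. [cite: Conrey1983, Lemma 2 (p. 52)] [cite: Titchmarsh1986, §9.4] -/
theorem exists_xiDerivZeroCount_le_mul_log (m : ℕ) :
    ∃ K T₀ : ℝ, 0 < K ∧ ∀ T : ℝ, T₀ ≤ T → (xiDerivZeroCount m T : ℝ) ≤ K * (T * Real.log T) := by
  obtain ⟨A, C, hA, hC1, hgr⟩ := norm_iteratedDeriv_riemannXi_le
  set c₀ : ℝ := Real.log ‖iteratedDeriv m riemannXi (5 / 2)‖ with hc₀
  set K₀ : ℝ := (Real.log C + |c₀|) / Real.log 2 with hK₀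
  have hlog2 : 0 < Real.log 2 := Real.log_pos (by norm_num)
  have hK₀0 : 0 ≤ K₀ := by
    rw [hK₀]; exact div_nonneg (add_nonneg (Real.log_nonneg hC1) (abs_nonneg _)) hlog2.le
  refine ⟨K₀ + 8 * A / Real.log 2 + 1, (10 : ℝ) + m, by positivity, fun T hT ↦ ?_⟩
  have hm0 : (0 : ℝ) ≤ m := Nat.cast_nonneg m
  have hT10 : 10 ≤ T := by linarith
  have hT0 : 0 ≤ T := by linarith
  have hlogT : 1 ≤ Real.log T := by
    rw [← Real.log_exp 1]
    exact Real.log_le_log (Real.exp_pos 1) (by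
      have := Real.exp_one_lt_d9; linarith)
  have hTlogT : 1 ≤ T * Real.log T := by nlinarith
  -- the Jensen bound with `M = C exp(A (2T + 9 + m) log(2T + 10 + m))`
  set L : ℝ := A * (2 * T + 9 + m) * Real.log (2 * T + 10 + m) with hL
  have hL0 : 0 ≤ L := by
    rw [hL]
    exact mul_nonneg (mul_nonneg hA (by linarith)) (Real.log_nonneg (by linarith))
  have hM1 : 1 ≤ C * Real.exp L := by
    have := Real.one_le_exp hL0
    nlinarith
  have hM : ∀ z ∈ sphere (5 / 2 : ℂ) (2 * (T + 3)), ‖iteratedDeriv m riemannXi z‖ ≤ C * Real.exp L := by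
    intro z hz
    have hz1 : ‖z‖ ≤ 2 * T + 17 / 2 := by
      have h1 : ‖z - 5 / 2‖ = 2 * (T + 3) := by rwa [mem_sphere_iff_norm] at hz
      have h52 : ‖(5 / 2 : ℂ)‖ = 5 / 2 := by
        rw [show (5 / 2 : ℂ) = ((5 / 2 : ℝ) : ℂ) by push_cast; ring, Complex.norm_real]
        norm_num
      calc ‖z‖ = ‖(z - 5 / 2) + 5 / 2‖ := by ring_nf
        _ ≤ ‖z - 5 / 2‖ + ‖(5 / 2 : ℂ)‖ := norm_add_le _ _
        _ = 2 * T + 17 / 2 := by rw [h1, h52]; ring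
    refine (hgr m z).trans (mul_le_mul_of_nonneg_left (Real.exp_le_exp.2 ?_) (by linarith))
    rw [hL]
    have h1 : ‖z‖ + (m : ℝ) ≤ 2 * T + 9 + m := by linarith
    have h2 : Real.log (1 + ‖z‖ + m) ≤ Real.log (2 * T + 10 + m) :=
      Real.log_le_log (by positivity) (by linarith)
    have h3 : 0 ≤ Real.log (1 + ‖z‖ + m) := Real.log_nonneg (by linarith [norm_nonneg z])
    have h4 : 0 ≤ A * (2 * T + 9 + m) := by positivity
    calc A * (‖z‖ + m) * Real.log (1 + ‖z‖ + m)
        ≤ A * (2 * T + 9 + m) * Real.log (1 + ‖z‖ + m) := by gcongr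
      _ ≤ A * (2 * T + 9 + m) * Real.log (2 * T + 10 + m) := mul_le_mul_of_nonneg_left h2 h4
  have hJ := xiDerivZeroCount_le_jensen m hT0 hM1 hM
  -- evaluate the logarithm
  have hfc : 0 < ‖iteratedDeriv m riemannXi (5 / 2)‖ :=
    norm_pos_iff.2 (iteratedDeriv_riemannXi_ne_zero_of_one_le_re m (by norm_num))
  have hlogM : Real.log (C * Real.exp L / ‖iteratedDeriv m riemannXi (5 / 2)‖) =
      Real.log C + L - c₀ := by
    rw [Real.log_div (by positivity) hfc.ne', Real.log_mul (by positivity) (Real.exp_pos _).ne',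
      Real.log_exp, hc₀]
  rw [hlogM] at hJ
  -- `L ≤ 8 A T log T` for `T ≥ 10 + m`
  have hLle : L ≤ 8 * A * (T * Real.log T) := by
    have h1 : 2 * T + 9 + m ≤ 4 * T := by linarith
    have h2 : Real.log (2 * T + 10 + m) ≤ 2 * Real.log T := by
      have h4T : 2 * T + 10 + m ≤ 4 * T := by linarith
      have hlog4 : Real.log 4 ≤ Real.log T := Real.log_le_log (by norm_num) (by linarith)
      calc Real.log (2 * T + 10 + m) ≤ Real.log (4 * T) :=
            Real.log_le_log (by positivity) h4T
        _ = Real.log 4 + Real.log T := Real.log_mul (by norm_num) (by linarith)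
        _ ≤ 2 * Real.log T := by linarith
    have h3 : 0 ≤ Real.log (2 * T + 10 + m) := Real.log_nonneg (by linarith)
    calc L = A * (2 * T + 9 + m) * Real.log (2 * T + 10 + m) := hL
      _ ≤ A * (4 * T) * Real.log (2 * T + 10 + m) := by gcongr
      _ ≤ A * (4 * T) * (2 * Real.log T) :=
          mul_le_mul_of_nonneg_left h2 (by positivity)
      _ = 8 * A * (T * Real.log T) := by ring
  have hconst : (Real.log C + L - c₀) / Real.log 2 ≤
      K₀ * (T * Real.log T) + 8 * A / Real.log 2 * (T * Real.log T) := by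
    rw [div_le_iff₀ hlog2]
    have e : (K₀ * (T * Real.log T) + 8 * A / Real.log 2 * (T * Real.log T)) * Real.log 2 =
        (Real.log C + |c₀|) * (T * Real.log T) + 8 * A * (T * Real.log T) := by
      rw [hK₀]; field_simp
    rw [e]
    have h1 : Real.log C + L - c₀ ≤ (Real.log C + |c₀|) + L := by linarith [neg_abs_le c₀]
    have h2 : Real.log C + |c₀| ≤ (Real.log C + |c₀|) * (T * Real.log T) := by
      have h0 : 0 ≤ Real.log C + |c₀| := add_nonneg (Real.log_nonneg hC1) (abs_nonneg _)
      nlinarith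
    linarith
  calc (xiDerivZeroCount m T : ℝ) ≤ (Real.log C + L - c₀) / Real.log 2 := hJ
    _ ≤ K₀ * (T * Real.log T) + 8 * A / Real.log 2 * (T * Real.log T) := hconst
    _ ≤ (K₀ + 8 * A / Real.log 2 + 1) * (T * Real.log T) := by nlinarith

/-- **Conrey's theorem, qualitative form, for every `m`: a positive proportion of the zeros of `ξ^{(m)}`
lies on the critical line — `0 < κ′_m = liminf_T N^{(m)}₀(T)/N^{(m)}(T)`, unconditionally.**
(Conrey proves `κ′₁ ≥ 0.8137`, `κ′₂ ≥ 0.9584`, …; here only `κ′_m > 0`, from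
`N^{(m)}₀(T) ≥ (1/3)(T/2π) log T` and `N^{(m)}(T) ≤ K T log T` for large `T`.)
[cite: Conrey1983, Theorem and Corollary (pp. 49–50)] -/
theorem xiDerivCriticalLineProportion_pos (m : ℕ) : 0 < xiDerivCriticalLineProportion m := by
  obtain ⟨K, T₀, hK, hN⟩ := exists_xiDerivZeroCount_le_mul_log m
  have hlow := eventually_two_thirds_mul_main_le_xiDerivCriticalZeroCount_higher m (1 / 3)
    (by norm_num)
  set c : ℝ := 1 / (6 * Real.pi * K) with hc
  have hcpos : 0 < c := by rw [hc]; positivity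
  refine lt_of_lt_of_le hcpos (le_xiDerivCriticalLineProportion_of_eventually_le m ?_)
  filter_upwards [hlow, eventually_ge_atTop T₀, eventually_ge_atTop (1 : ℝ)] with T hT hTT₀ hT1
  have hNT := hN T hTT₀
  have hTlog : 0 ≤ T * Real.log T := mul_nonneg (by linarith) (Real.log_nonneg hT1)
  have e : c * (K * (T * Real.log T)) = (2 / 3 - 1 / 3) * (T / (2 * Real.pi) * Real.log T) := by
    rw [hc]; field_simp; ring
  calc c * (xiDerivZeroCount m T : ℝ) ≤ c * (K * (T * Real.log T)) :=
        mul_le_mul_of_nonneg_left hNT hcpos.le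
    _ = (2 / 3 - 1 / 3) * (T / (2 * Real.pi) * Real.log T) := e
    _ ≤ xiDerivCriticalZeroCount m T := hT

/-- `m = 1`: a positive proportion of the zeros of `ξ′` is on the critical line (the tree also has the
quantitative `0.6725 ≤ κ′₁`, `xiDerivCriticalLineProportion_one_ge_06725`); `m = 2`: a positive proportion
of the zeros of `ξ″` is on the critical line — new for the tree. [cite: Conrey1983, Corollary (p. 50)] -/
theorem xiDerivCriticalLineProportion_two_pos : 0 < xiDerivCriticalLineProportion 2 :=
  xiDerivCriticalLineProportion_pos 2

end Literature.NumberTheory.LFunctions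

end
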